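import Literature.MathematicalPhysics.KineticTheory.LangevinChainNESSHolds
import Summits.AtomisticToContinuum.FouriersLaw.Theorems.BondHeatUncertaintySubdiffusiveBondHeatJunctionRatioWeakResponse

/-!
# Crux `ExtensiveSnapshotIrreversibility` (stmt-AtomisticToContinuum-9121): first rungs under the atoms of `(W)`

Cell decomp-a2c, lens «grading / quantitative ladder», generation 71; companion of
`…EnergyWindowAtoms.lean` (the five atoms A0–A4 of the energy-window control `(W)` and the glue
`A0 → … → A4 → (W)`). This file depends on `Literature` ONLY (it elaborates on the farm as is) and
proves the two first rungs named there:

* `generator_eq_generator_add_bathDefect`, `generator_window_eq`,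
  `integral_generator_add_defect_eq_zero` — **the `O(δ)` defect identity (foot of A3 `NessDensityFloor`
  and A4 `NessLinearResponseL2`)**: the generator of the chain is affine in the bath temperatures,
  `L_{T+δ/2,T−δ/2} = L_{T,T} + (γδ/2)(∂²_{p_0} − ∂²_{p_{N−1}})`, so every weak steady state at
  `(T+δ/2, T−δ/2)` is an `O(δ)`-defective weak steady state of `L_{T,T}`:
  `∫ (L_{T,T} f + (γδ/2)(∂²_{p_0} f − ∂²_{p_{N−1}} f)) dμ_δ = 0` for all `f ∈ C_c^∞` — with
  `μ_δ = f_δ μ_T` the weak form of `L_{T,T}^† f_δ = −(γδ/2)(∂²_{p_0} − ∂²_{p_{N−1}})^† f_δ`, whose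
  `δ → 0` limit is the response equation `L_{T,T}^† g₀ = (γ/2T²)(p_0² − p_{N−1}²)` behind A4 and whose
  `e^{θH}`-weighted resolvent form is the source of the one-sided floor A3;
* `integrable_exp_mul_hamiltonian_of_isSteadyState`, `ness_integrable_exp_mul_hamiltonian` — **the
  integrability half of A1 `NessExpMomentBound`**: under weak-NESS uniqueness EVERY steady state of
  the pinned chain integrates `e^{θH}` for `0 < θ < 1/max(T_L, T_R)` (the steady state of
  `CuneoEckmannHairerReyBellet2018_pinnedChain_holds` — H2 + Hörmander, proved in the tree — does, and
  it is the given one), hence along the family `μ_{N,T+δ/2,T−δ/2}` for `|δ| < δ₀ < 2T`,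
  `θ < 1/(T + δ₀/2)`. The remaining half of A1 — a bound on `∫ e^{θH} dμ_δ` UNIFORM in `|δ| < δ₀` —
  is CEHR Thm 5.1 / Rem 5.2 with constants locally uniform in the bath temperatures (open item).

References: F. Bonetto, J. L. Lebowitz, L. Rey-Bellet, in: Mathematical Physics 2000, §4.1 eq. (10)
(the generator), §6 (linear response); N. Cuneo, J.-P. Eckmann, M. Hairer, L. Rey-Bellet, EJP 23
(2018) no. 55, Thm 2.13.
-/

noncomputable section

namespace Summit.AtomisticToContinuum.FouriersLaw.Theorems.ExtensiveSnapshotIrreversibility.EnergyWindow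

open MeasureTheory Filter Topology
open scoped ENNReal NNReal
open Literature.MathematicalPhysics.KineticTheory.HeatConduction

/-! ## 1. The generator is affine in the bath temperatures: the `O(δ)` defect identity
(foot of A3/A4) -/

-- `generator_eq_generator_add_bathDefect` (the generator is affine in the bath temperatures) is ALREADY LANDED as
-- `…SubdiffusiveBondHeat.EscapeGrading.generator_tilt` (gate dedup.landed at landing, hand-2 g27): reused below, copy deleted.

/-- **At `(T_L, T_R) = (T + δ/2, T − δ/2)`**:
`L_{T+δ/2,T−δ/2} f = L_{T,T} f + (γδ/2) ∑_i ([i = 0] − [i = N−1]) ∂²_{p_i} f`. [folklore] -/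
theorem generator_window_eq (P : OscillatorChain) (N : ℕ) (T δ : ℝ) (f : PhaseSpace N → ℝ)
    (x : PhaseSpace N) :
    P.generator N (T + δ / 2) (T - δ / 2) f x = P.generator N T T f x +
      P.γ * (δ / 2) * ∑ i : Fin N, ((if i.val = 0 then partialP i (partialP i f) x else 0) -
        (if i.val = N - 1 then partialP i (partialP i f) x else 0)) := by
  rw [Summit.AtomisticToContinuum.FouriersLaw.Theorems.SubdiffusiveBondHeat.EscapeGrading.generator_tilt P N T]
  congr 1
  rw [mul_assoc]
  congr 1
  rw [Finset.mul_sum]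
  refine Finset.sum_congr rfl fun i _ => ?_
  split_ifs <;> ring

/-- **The `O(δ)` defect identity (first lemma toward A3/A4).** Every weak steady state `ν` of a
chain at bath temperatures `(T + δ/2, T − δ/2)` is an `O(δ)`-defective weak steady state at `(T, T)`:
for every `f ∈ C_c^∞`,
`∫ (L_{T,T} f + (γδ/2)(∂²_{p_0} f − ∂²_{p_{N−1}} f)) dν = 0`.
With `ν = f_δ μ_T` this is the weak equation `L_{T,T}^† f_δ = −(γδ/2)(∂²_{p_0} − ∂²_{p_{N−1}})^† f_δ`
in `L²(μ_T)` whose `δ → 0` limit is the response equation of A4 and whose weighted resolvent form is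
the source of A3. [folklore] -/
theorem integral_generator_add_defect_eq_zero (P : OscillatorChain) {N : ℕ} {T δ : ℝ}
    {ν : Measure (PhaseSpace N)} (hν : P.IsSteadyState N (T + δ / 2) (T - δ / 2) ν)
    {f : PhaseSpace N → ℝ} (hf : ContDiff ℝ ((⊤ : ℕ∞) : WithTop ℕ∞) f)
    (hfc : HasCompactSupport f) :
    ∫ x, (P.generator N T T f x + P.γ * (δ / 2) *
        ∑ i : Fin N, ((if i.val = 0 then partialP i (partialP i f) x else 0) -
          (if i.val = N - 1 then partialP i (partialP i f) x else 0))) ∂ν = 0 := by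
  have h := hν.2.1 f hf hfc
  refine Eq.trans (integral_congr_ae (Eventually.of_forall fun x => ?_)) h
  exact (generator_window_eq P N T δ f x).symm

/-! ## 2. The integrability half of A1 from Cuneo–Eckmann–Hairer–Rey-Bellet 2018, Thm 2.13 -/

/-- **Every steady state integrates `e^{θH}`, `θ < 1/max(T_L,T_R)`** (under weak-NESS uniqueness):
the steady state provided by `CuneoEckmannHairerReyBellet2018_pinnedChain_holds` (proved in the tree:
H2 + Hörmander) has this property, and by uniqueness it is the given one.
[cite: CuneoEckmannHairerReyBellet2018, Thm 2.13] -/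
theorem integrable_exp_mul_hamiltonian_of_isSteadyState {ω₂ lam β γ : ℝ} (hω : 0 < ω₂)
    (hl : 0 < lam) (hβ : 0 < β) (hγ : 0 < γ)
    (hU : ∀ (N : ℕ) (T_L T_R : ℝ), 0 < T_L → 0 < T_R → ∀ μ ν : Measure (PhaseSpace N),
      (pinnedChain ω₂ lam β γ).IsSteadyState N T_L T_R μ →
      (pinnedChain ω₂ lam β γ).IsSteadyState N T_L T_R ν → μ = ν)
    {N : ℕ} (hN : 0 < N) {T_L T_R : ℝ} (hTL : 0 < T_L) (hTR : 0 < T_R)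
    {ν : Measure (PhaseSpace N)} (hν : (pinnedChain ω₂ lam β γ).IsSteadyState N T_L T_R ν)
    {θ : ℝ} (hθ : 0 < θ) (hθ' : θ < 1 / max T_L T_R) :
    Integrable (fun x => Real.exp (θ * (pinnedChain ω₂ lam β γ).hamiltonian N x)) ν := by
  obtain ⟨μ', hμ', -, hint⟩ :=
    CuneoEckmannHairerReyBellet2018_pinnedChain_holds ω₂ lam β γ hω hl hβ hγ N T_L T_R hN hTL hTR
  rw [hU N T_L T_R hTL hTR ν μ' hν hμ']
  exact hint θ hθ hθ'

/-- **The integrability half of A1 along the family**: for `T > 0`, `0 < δ₀ < 2T`,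
`0 < θ < 1/(T + δ₀/2)` and `N ≥ 1`, `e^{θH} ∈ L¹(μ_{N,T+δ/2,T−δ/2})` for every `|δ| < δ₀`.
[cite: CuneoEckmannHairerReyBellet2018, Thm 2.13] -/
theorem ness_integrable_exp_mul_hamiltonian {ω₂ lam β γ : ℝ} (hω : 0 < ω₂) (hl : 0 < lam)
    (hβ : 0 < β) (hγ : 0 < γ)
    (hU : ∀ (N : ℕ) (T_L T_R : ℝ), 0 < T_L → 0 < T_R → ∀ μ ν : Measure (PhaseSpace N),
      (pinnedChain ω₂ lam β γ).IsSteadyState N T_L T_R μ →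
      (pinnedChain ω₂ lam β γ).IsSteadyState N T_L T_R ν → μ = ν)
    (μ : (N : ℕ) → ℝ → ℝ → Measure (PhaseSpace N))
    (hμ : ∀ (N : ℕ) (T_L T_R : ℝ), 0 < T_L → 0 < T_R →
      (pinnedChain ω₂ lam β γ).IsSteadyState N T_L T_R (μ N T_L T_R))
    {T : ℝ} {N : ℕ} (hN : 0 < N) {δ₀ : ℝ} (hδ₀T : δ₀ < 2 * T)
    {θ : ℝ} (hθ : 0 < θ) (hθ' : θ < 1 / (T + δ₀ / 2)) {δ : ℝ} (hδ : |δ| < δ₀) :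
    Integrable (fun x => Real.exp (θ * (pinnedChain ω₂ lam β γ).hamiltonian N x))
      (μ N (T + δ / 2) (T - δ / 2)) := by
  obtain ⟨hδ1, hδ2⟩ := abs_lt.1 hδ
  have hTL : 0 < T + δ / 2 := by linarith
  have hTR : 0 < T - δ / 2 := by linarith
  have hmax : max (T + δ / 2) (T - δ / 2) < T + δ₀ / 2 := max_lt (by linarith) (by linarith)
  have hmax0 : 0 < max (T + δ / 2) (T - δ / 2) := lt_max_of_lt_left hTL
  have hθ'' : θ < 1 / max (T + δ / 2) (T - δ / 2) :=
    hθ'.trans (one_div_lt_one_div_of_lt hmax0 hmax)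
  exact integrable_exp_mul_hamiltonian_of_isSteadyState hω hl hβ hγ hU hN hTL hTR
    (hμ N _ _ hTL hTR) hθ hθ''

end Summit.AtomisticToContinuum.FouriersLaw.Theorems.ExtensiveSnapshotIrreversibility.EnergyWindow

end
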